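import Summits.AnomalousDissipation.AnomalousDissipation.Theorems.SawtoothPulseCascadeK1LocalisedCascadeHalfStepHCTGTracked

/-!
# K1loc — helper: THE H HALF-STEP IN ALL-ORDERS CORNER-TRACE GRADE («CT-GEO» half-step; finding F-p1g9-1, memo v15)

Port of `…HalfStepHCTS.sum_window_sq_norm_hstep_ct_split_le` (coordinate swap `0 ↔ 1` of `…HalfStepVCTGTracked`) (same frame, same proof skeleton: coefficient identity on each
fibre, exact chirp + rounding off the corner zones + pass-through) with the per-fibre kernel replaced by the all-orders bound
`…CornerTraceGeomSum(Neg).cornerTraceGeom_sum_sq_le(_neg)` and its closed-form scalars `…CornerTraceGeomTau`.  The window is a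
box: `|k₀| ≤ K` on fibres `|k₁| ≥ n₀` with `K + L + D ≤ n₀G` (the gap at the bottom fibre) and `K + 1 ≤ n₀G − Λ`; the corner-trace
inputs are INDEXED BY THE ORDER: `Θ^±` bound `Σ_{n ≷ 0} |Σ_l χ_l l^i 𝓕b(l,n) e^{2πily}|² ≤ Λ^{2i}Θ^±` for all `i < p` and all `y`
(for the box trapezoid `Λ = L_supp − 1`, `…TraceKernelsDeriv`).  Conclusion:
  `Σ_{k∈W} |𝓕(b∘Φ_H)(k)|² ≤ (√(c₁(Θ⁺+Θ⁻) + c₂E) + √(η²E + 8Mδ_j(Θ⁺+Θ⁻)/π) + √PT)²`,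
  `c₁ = (1+ε)(N²/π²)·(8λ′²/(λ′²−K²)² + 8(K+½)/(N(λ′²−(K+½)²)))`, `λ′ = n₀G − Λ` (NO residue term),
  `c₂ = (1+ε⁻¹)(N²/π²)·(4/D²)(1/S^{2p} + 1/(NS^{2p−1}))·(2L/N+1)L^{2p}`, `S = D + L` (the order-`p` remainder, negligible for large `p`).
No definitions; nothing about the crux. [cite: Grafakos2014, Prop. 3.1.2 (5), Prop. 3.2.7 (3), §3.1.3] [problem: turb]
-/

-- `Summit.<Summit>.<Problem>`: single-conjunct summit, the duplicate namespace segment is deliberate.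
set_option linter.dupNamespace false

namespace Summit.AnomalousDissipation.AnomalousDissipation.Theorems.SawtoothPulseCascade.K1Window

open MeasureTheory Set Filter Topology UnitAddTorus Function Complex Metric
open scoped Real ENNReal
open Literature.Analysis Literature.Analysis.FunctionSpaces Literature.Analysis.FunctionSpaces.Torus Literature.Analysis.FluidPDE
open Literature.Analysis.FluidPDE.ShearStage
open Literature.Analysis.FluidPDE.SawtoothCascade Literature.Analysis.FluidPDE.SawtoothCascade.CascadeParams
open Summit.AnomalousDissipation.AnomalousDissipation.Theorems.SawtoothPulseCascade.K1Start
open Summit.AnomalousDissipation.AnomalousDissipation.Theorems.SawtoothPulseCascade.K1Flat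

set_option maxHeartbeats 1600000 in
/-- **THE H HALF-STEP, ALL-ORDERS CORNER-TRACE GRADE** (see the file header).  Data: integer strain `γ = G`, continuous input `b`
with summable coefficients, box window `W` (`|k₀| ≤ K`, `|k₁| ≥ n₀`), source multiplier `χ` supported in `Sχ ⊂ [−L, L]` with
`|χ| ≤ 1`, gap `D ≥ 1` with `K + L + D ≤ n₀G`, order `p ≥ 1`, weight base `Λ > 0` with `K + 1 ≤ n₀G − Λ`, indexed sign-split
corner-trace bounds `Θ⁺, Θ⁻` (orders `i < p`, all real `y`), tracked energy bound `E`, zone parameter `M ≥ 1` with `Mδ_j < π/2`,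
rounding amplitude `η`, `ε > 0`.  Conclusion: `Σ_{k∈W}|𝓕(b∘Φ_H)(k)|² ≤ (√J_CTG + √J_round + √PT)²`.
[cite: Grafakos2014, Prop. 3.1.2 (5), Prop. 3.2.7 (3)] -/
theorem sum_window_sq_norm_hstep_ctg_le (P : CascadeParams) {G : ℕ} (hγ : P.γ = G) (hδ₀ : 0 < P.δ₀) (hd : 0 < P.d)
    (hN₀ : 1 ≤ P.N₀) (hρN : 1 ≤ P.ρN) (j : ℕ)
    {b : UnitAddTorus (Fin 2) → ℂ} (hb : Continuous b) (hbs : Summable fun k => ‖mFourierCoeff b k‖)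
    (W : Finset (Fin 2 → ℤ)) (χ : ℤ → ℂ) (Sχ : Finset ℤ) (hχS : ∀ l, l ∉ Sχ → χ l = 0) (hχ1 : ∀ l, ‖χ l‖ ≤ 1)
    {L D K n₀ : ℕ} (hSL : ∀ l ∈ Sχ, |l| ≤ L) (hD : 0 < D) (hWK : ∀ k ∈ W, |k 1| ≤ (K : ℤ))
    (hWn₀ : ∀ k ∈ W, (n₀ : ℤ) ≤ |k 0|) (hKD : (K : ℤ) + L + D ≤ (n₀ : ℤ) * G)
    {p : ℕ} (hp : 1 ≤ p) {Λ : ℝ} (hΛ : 0 < Λ) (hedge : (K : ℝ) + 1 ≤ (n₀ : ℝ) * G - Λ)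
    {Θp Θm E M η ε : ℝ} (hε : 0 < ε)
    (hΘp : ∀ i ∈ Finset.range p, ∀ y : ℝ, ∑ n ∈ (W.image (fun k => k 0)).filter (fun n => 0 < n),
      ‖∑ l ∈ Sχ, χ l * (l : ℂ) ^ i * mFourierCoeff b ![n, l] * cexp (2 * π * I * l * y)‖ ^ 2 ≤ Λ ^ (2 * i) * Θp)
    (hΘm : ∀ i ∈ Finset.range p, ∀ y : ℝ, ∑ n ∈ (W.image (fun k => k 0)).filter (fun n => n < 0),
      ‖∑ l ∈ Sχ, χ l * (l : ℂ) ^ i * mFourierCoeff b ![n, l] * cexp (2 * π * I * l * y)‖ ^ 2 ≤ Λ ^ (2 * i) * Θm)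
    (hE : ∑ n ∈ W.image (fun k => k 0), ∑ l ∈ Sχ, ‖χ l * mFourierCoeff b ![n, l]‖ ^ 2 ≤ E)
    (hM : 1 ≤ M) (hMδ : M * P.δ j < π / 2)
    (hη : ∀ k ∈ W, 2 * π * |((k 0 * G : ℤ) : ℝ)| * (Real.exp (-(M ^ 2 / 2)) / (2 * P.N j)) ≤ η) :
    ∑ k ∈ W, ‖mFourierCoeff (b ∘ shearMap 0 1 (amp ⟨P.U j, P.U_periodic j, P.contDiff_U (P.δ_pos hδ₀ hd j)⟩ P.γ)) k‖ ^ 2 ≤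
      (Real.sqrt ((1 + ε) * ((P.N j : ℝ) ^ 2 / π ^ 2) *
              (8 * ((n₀ : ℝ) * G - Λ) ^ 2 / (((n₀ : ℝ) * G - Λ) ^ 2 - (K : ℝ) ^ 2) ^ 2 +
                8 * ((K : ℝ) + 1 / 2) / (P.N j * (((n₀ : ℝ) * G - Λ) ^ 2 - ((K : ℝ) + 1 / 2) ^ 2))) * (Θp + Θm) +
            (1 + ε⁻¹) * ((P.N j : ℝ) ^ 2 / π ^ 2) * (4 / (D : ℝ) ^ 2 * (1 / ((D : ℝ) + L) ^ (2 * p) +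
              1 / (P.N j * ((D : ℝ) + L) ^ (2 * p - 1)))) * ((2 * (L : ℝ) / P.N j + 1) * (L : ℝ) ^ (2 * p)) * E) +
          Real.sqrt (η ^ 2 * E + 8 * M * P.δ j / π * (Θp + Θm)) +
        Real.sqrt (∑ n ∈ W.image (fun k => k 0), ∫ x : UnitAddTorus (Fin 2),
          ‖∫ s : UnitAddCircle, (fourier (-n) s : ℂ) •
            (b (x + Pi.single (0 : Fin 2) s) - ∑ l ∈ Sχ, χ l * ∫ s' : UnitAddCircle,
              (fourier (-l) s' : ℂ) • b (x + Pi.single (0 : Fin 2) s + Pi.single (1 : Fin 2) s'))‖ ^ 2)) ^ 2 := by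
  classical
  obtain ⟨hπ, h10⟩ : 0 < π ∧ (0 : Fin 2) ≠ 1 := ⟨Real.pi_pos, by decide⟩
  set Ψ : ShearProfile := amp ⟨P.U j, P.U_periodic j, P.contDiff_U (P.δ_pos hδ₀ hd j)⟩ P.γ with hΨ
  -- the input cut-off and its complement
  set T : UnitAddTorus (Fin 2) → ℂ := fun x => ∑ l ∈ Sχ, χ l *
    ∫ s : UnitAddCircle, (fourier (-l) s : ℂ) • b (x + Pi.single (1 : Fin 2) s) with hT
  have hTc : Continuous T := continuous_finsetSum _ fun l _ => continuous_const.mul (continuous_twistedAxisAvg hb 1 l)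
  set θ₂ : UnitAddTorus (Fin 2) → ℂ := fun x => b x - T x with hθ₂
  have hθ₂c : Continuous θ₂ := hb.sub hTc
  have hsum : (fun x => T x + θ₂ x) = b := by funext x; simp [hθ₂]
  set F : Finset ℤ := W.image fun k => k 0 with hF
  have hmaps : ∀ k ∈ W, k 0 ∈ F := fun k hk => Finset.mem_image_of_mem _ hk
  -- the tracked part
  have hTpart := sum_window_sq_norm_tracked_hstep_ctg_le P hγ hδ₀ hd hN₀ hρN j hb hbs W χ Sχ hχS hχ1 hSL hD hWK hWn₀ hKD hp hΛ
    hedge hε hΘp hΘm hE hM hMδ hη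
  -- (8) the pass-through part and the assembly
  set H₂ : ℤ → UnitAddTorus (Fin 2) → ℂ := fun n x => twist Ψ n (x 1) *
    ∫ s : UnitAddCircle, (fourier (-n) s : ℂ) • θ₂ (x + Pi.single (0 : Fin 2) s) with hH₂
  have hH₂c : ∀ n, Continuous (H₂ n) := fun n =>
    ((continuous_twist Ψ n).comp (continuous_apply (1 : Fin 2))).mul (continuous_twistedAxisAvg hθ₂c 0 n)
  have hcoef : ∀ k ∈ W, mFourierCoeff ((fun x => T x + θ₂ x) ∘ shearMap 0 1 Ψ) k =
      mFourierCoeff (T ∘ shearMap 0 1 Ψ) k + mFourierCoeff (H₂ (k 0)) k := by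
    intro k _
    have hs : ((fun x => T x + θ₂ x) ∘ shearMap 0 1 Ψ) = (T ∘ shearMap 0 1 Ψ) + (θ₂ ∘ shearMap 0 1 Ψ) := rfl
    rw [hs, Torus.mFourierCoeff_add (F := ℂ) ((hTc.comp (continuous_shearMap 0 1 Ψ)).integrable_unitAddTorus)
      ((hθ₂c.comp (continuous_shearMap 0 1 Ψ)).integrable_unitAddTorus),
      mFourierCoeff_comp_shearMap_eq_chirp hθ₂c h10 Ψ k]
  have hMk : ∑ k ∈ W, ‖mFourierCoeff ((fun x => T x + θ₂ x) ∘ shearMap 0 1 Ψ) k‖ ^ 2 ≤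
      (Real.sqrt (∑ k ∈ W, ‖mFourierCoeff (T ∘ shearMap 0 1 Ψ) k‖ ^ 2) +
        Real.sqrt (∑ k ∈ W, ‖mFourierCoeff (H₂ (k 0)) k‖ ^ 2)) ^ 2 := by
    have h1 : ∑ k ∈ W, ‖mFourierCoeff ((fun x => T x + θ₂ x) ∘ shearMap 0 1 Ψ) k‖ ^ 2 ≤
        ∑ k ∈ W, (‖mFourierCoeff (T ∘ shearMap 0 1 Ψ) k‖ + ‖mFourierCoeff (H₂ (k 0)) k‖) ^ 2 := by
      refine Finset.sum_le_sum fun k hk => ?_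
      rw [hcoef k hk]
      exact pow_le_pow_left₀ (norm_nonneg _) (norm_add_le _ _) 2
    have h2 := SpectralLeakage.sqrt_sum_add_sq_le W (a := fun k => ‖mFourierCoeff (T ∘ shearMap 0 1 Ψ) k‖)
      (b := fun k => ‖mFourierCoeff (H₂ (k 0)) k‖) (fun k _ => norm_nonneg _) (fun k _ => norm_nonneg _)
    have h0 : 0 ≤ ∑ k ∈ W, (‖mFourierCoeff (T ∘ shearMap 0 1 Ψ) k‖ + ‖mFourierCoeff (H₂ (k 0)) k‖) ^ 2 :=
      Finset.sum_nonneg fun k _ => sq_nonneg _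
    calc _ ≤ _ := h1
      _ = (Real.sqrt (∑ k ∈ W, (‖mFourierCoeff (T ∘ shearMap 0 1 Ψ) k‖ + ‖mFourierCoeff (H₂ (k 0)) k‖) ^ 2)) ^ 2 :=
          (Real.sq_sqrt h0).symm
      _ ≤ _ := pow_le_pow_left₀ (Real.sqrt_nonneg _) h2 2
  have hPT : ∑ k ∈ W, ‖mFourierCoeff (H₂ (k 0)) k‖ ^ 2 ≤ ∑ n ∈ F,
      ∫ x : UnitAddTorus (Fin 2), ‖∫ s : UnitAddCircle, (fourier (-n) s : ℂ) • θ₂ (x + Pi.single (0 : Fin 2) s)‖ ^ 2 := by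
    rw [← Finset.sum_fiberwise_of_maps_to hmaps]
    refine Finset.sum_le_sum fun n _ => ?_
    calc ∑ k ∈ W with k 0 = n, ‖mFourierCoeff (H₂ (k 0)) k‖ ^ 2
        = ∑ k ∈ W with k 0 = n, ‖mFourierCoeff (H₂ n) k‖ ^ 2 :=
          Finset.sum_congr rfl fun k hk => by rw [(Finset.mem_filter.mp hk).2]
      _ ≤ ∫ x : UnitAddTorus (Fin 2), ‖H₂ n x‖ ^ 2 := sum_sq_norm_mFourierCoeff_le_integral (hH₂c n) _
      _ = ∫ x : UnitAddTorus (Fin 2), ‖∫ s : UnitAddCircle, (fourier (-n) s : ℂ) • θ₂ (x + Pi.single (0 : Fin 2) s)‖ ^ 2 :=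
          integral_congr_ae (Eventually.of_forall fun x => by simp only [hH₂, norm_mul, norm_twist, one_mul])
  have hTsqrt := (Real.sqrt_le_sqrt hTpart).trans (le_of_eq (Real.sqrt_sq (by positivity)))
  rw [hsum] at hMk
  refine hMk.trans (pow_le_pow_left₀ (add_nonneg (Real.sqrt_nonneg _) (Real.sqrt_nonneg _))
    (add_le_add ?_ (Real.sqrt_le_sqrt hPT)) 2)
  exact hTsqrt

end Summit.AnomalousDissipation.AnomalousDissipation.Theorems.SawtoothPulseCascade.K1Window
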